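import Summits.BirchSwinnertonDyer.BirchSwinnertonDyer.Theorems.BiquadraticEisensteinDescentHeegnerTwistCouplingInSupplyQuarticCornerAllP
import Summits.BirchSwinnertonDyer.BirchSwinnertonDyer.Theorems.BiquadraticEisensteinDescentHeegnerTwistCouplingInSupplyQuarticMinusTripleRowsHigh
import Summits.BirchSwinnertonDyer.BirchSwinnertonDyer.Theorems.BiquadraticEisensteinDescentHeegnerTwistCouplingInSupplyQuarticPlusThreeRowsHigh
import HarnessLib

set_option linter.dupNamespace false -- `Summit.BirchSwinnertonDyer.BirchSwinnertonDyer.Theorems.…` (summit = sub)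
set_option autoImplicit false

/-!
# Crux `HeegnerTwistCouplingInSupply` (stmt-BirchSwinnertonDyer-21381) — the whole QUARTIC `j = 1728` LAYER below `20000`:
# the crux body, verbatim, for every `W ∈ {X_n, X_{n³} (n ≡ 15 (16)), X_n (n ≡ 3 (16)), W_n⁻, W_{n³}⁻ (n ≡ 7 (8))}`, ONE named fact

Route `BiquadraticEisensteinDescent` (cell `pub/bsd-wall`, width seat `bsd-wall-cm-bed-w4` g14; `--supports` 21381, helper). One-name packaging of the
quartic corner theorems of this seat for the table: the universally quantified BODY of `HeegnerTwistCouplingInSupply` (hypotheses `HasCM`, `r_an = 1`,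
`5 ≤ p`, `CMInert`, `¬ Good`, Heegner supply; conclusion a Heegner field `K′` of `N_W` with `4 < |d_{K′}|`, `L(W^{(d_{K′})}, 1) ≠ 0`, `p ∤ h(K′)`)
holds, modulo Burungale–Tian's rank-zero `2`-converse for CM curves ONLY, for every `W` in the odd-parity quartic-twist layer of `j = 1728` at a
prime `n`: `X_n = y² = x³ + n x` and `X_{n³}` for `n ≡ 15 (mod 16)` (EVERY `n`, `…QuarticCornerAllP`); `X_n` for `n ≡ 3 (mod 16)`, `19 ≤ n < 20000`
(`…QuarticPlusThreeRowsHigh`); `W_n⁻ = y² = x³ − n x` and `W_{n³}⁻` for `n ≡ 7 (mod 8)`, `23 ≤ n < 20000` (`…QuarticMinusTripleRowsHigh`). In each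
case `¬ Good W p ∧ 5 ≤ p` force `p = n`. Not covered in the layer: `W_7⁻`, `W_{343}⁻` (no triple with `h < 7`), the even-parity members
(`X_{n³}` at `n ≡ 3 (16)`, everything at `n ≡ 3, 11 (mod 16)` resp. `n ≡ 3 (mod 8)` on the `−` side — analytic rank even, outside the crux's
`r_an = 1`), the `±4n^k` members (untreated), and the finite ranges' complements.

HONEST FRAMING: typed sub-corners on ONE CM family (measure zero in «all CM `W` of analytic rank one»); the crux (residual C⁺) is NOT
closed; BSD is not proved by any of this. THEOREMS ONLY. Supports stmt-BirchSwinnertonDyer-21381.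
-/

noncomputable section

open scoped Classical NumberField

namespace Summit.BirchSwinnertonDyer.BirchSwinnertonDyer.Theorems.BiquadraticEisensteinDescentHeegnerTwistCouplingInSupplyQuarticLayerBelowTwenty

open _root_.WeierstrassCurve Literature.NumberTheory.EllipticCurves Literature.NumberTheory.EllipticCurves.Rank1Residual
open Summit.BirchSwinnertonDyer.BirchSwinnertonDyer.Theorems.BiquadraticEisensteinDescentHeegnerTwistCouplingInSupplyQuarticCornerAllP
  (heegnerTwistCouplingInSupply_Xpow)
open Summit.BirchSwinnertonDyer.BirchSwinnertonDyer.Theorems.BiquadraticEisensteinDescentHeegnerTwistCouplingInSupplyQuarticMinusTripleCorner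
  (eq_of_not_good_Wminus)
open Summit.BirchSwinnertonDyer.BirchSwinnertonDyer.Theorems.BiquadraticEisensteinDescentHeegnerTwistCouplingInSupplyQuarticMinusTripleCubeBelow
  (eq_of_not_good_Wcube)
open Summit.BirchSwinnertonDyer.BirchSwinnertonDyer.Theorems.BiquadraticEisensteinDescentHeegnerTwistCouplingInSupplyQuarticPlusThreeCorner
  (eq_of_not_good_Wplus)
open Summit.BirchSwinnertonDyer.BirchSwinnertonDyer.Theorems.BiquadraticEisensteinDescentHeegnerTwistCouplingInSupplyQuarticMinusTripleRowsHigh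
  (cruxOnQuarticMinusCornerBelowTwenty_of_BT cruxOnQuarticMinusCubeCornerBelowTwenty_of_BT)
open Summit.BirchSwinnertonDyer.BirchSwinnertonDyer.Theorems.BiquadraticEisensteinDescentHeegnerTwistCouplingInSupplyQuarticPlusThreeRowsHigh
  (cruxOnQuarticPlusThreeCornerBelowTwenty_of_BT)

/-- ★★ **THE CRUX BODY ON THE QUARTIC LAYER BELOW `20000`, ONE NAMED FACT.** For every `W` and prime `p` with the crux's hypotheses, if
`W` is one of: `X_n`, `X_{n³}` (`n` prime `≡ 15 (mod 16)`, any `n`); `X_n` (`n` prime `≡ 3 (mod 16)`, `19 ≤ n < 20000`); `W_n⁻`, `W_{n³}⁻`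
(`n` prime `≡ 7 (mod 8)`, `23 ≤ n < 20000`) — then there is a Heegner field `K′` of `N_W` with `4 < |d_{K′}|`, `L(W^{(d_{K′})}, 1) ≠ 0` and
`p ∤ h(K′)`, modulo Burungale–Tian ONLY. [cite: BurungaleTian2026, Thm. 1.1] [cite: SilvermanAEC2009, Prop. X.4.9 and Thm. X.4.2(a)]
[cite: Cohen1993, §5.3.1 Algorithm 5.3.5] [cite: IrelandRosen1990, Ch. 18 §6 Theorem 7] -/
theorem heegnerTwistCouplingInSupply_of_quarticLayer_lt_twenty
    (hBT : burungaleTian_analyticRank_eq_zero_of_selmerCorank_eq_zero_of_hasCM) :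
    ∀ (W : WeierstrassCurve ℚ) [W.IsElliptic] [W.IsGloballyMinimal] (p : ℕ) [Fact p.Prime] [NeZero (W.conductorNorm ℤ)],
      (∃ n : ℕ, n.Prime ∧
        ((n % 16 = 15 ∧ ∃ k : ℕ, (k = 1 ∨ k = 3) ∧ W = ⟨0, 0, 0, (n : ℚ) ^ k, 0⟩) ∨
         (n % 16 = 3 ∧ 19 ≤ n ∧ n < 20000 ∧ W = ⟨0, 0, 0, (n : ℚ), 0⟩) ∨
         (n % 8 = 7 ∧ 23 ≤ n ∧ n < 20000 ∧ (W = ⟨0, 0, 0, -(n : ℚ), 0⟩ ∨ W = ⟨0, 0, 0, -(n : ℚ) ^ 3, 0⟩)))) →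
      W.HasCM → W.analyticRank = 1 → 5 ≤ p → CMInert W p → ¬ Good W p →
      (∀ B : ℕ, ∃ (K : Type) (_ : Field K) (_ : NumberField K), IsImaginaryQuadratic K ∧ B < (NumberField.discr K).natAbs ∧
        4 < (NumberField.discr K).natAbs ∧ SatisfiesHeegnerHypothesis (W.conductorNorm ℤ) K ∧ ¬ p ∣ NumberField.classNumber K) →
      ∃ (K : Type) (_ : Field K) (_ : NumberField K),
        IsImaginaryQuadratic K ∧ 4 < (NumberField.discr K).natAbs ∧
        SatisfiesHeegnerHypothesis (W.conductorNorm ℤ) K ∧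
        (W.quadraticTwist (NumberField.discr K : ℚ)).entireLFunction 1 ≠ 0 ∧ ¬ p ∣ NumberField.classNumber K := by
  intro W _ _ p _ _ hW hCM hr h5 hinert hbad hsupply
  obtain ⟨n, hn, hcase⟩ := hW
  rcases hcase with ⟨hn16, k, hk, rfl⟩ | ⟨hn16, h19, h20000, rfl⟩ | ⟨hn8, h23, h20000, hWeq⟩
  · exact heegnerTwistCouplingInSupply_Xpow hBT hn hn16 hk p hCM hr h5 hinert hbad hsupply
  · obtain rfl := eq_of_not_good_Wplus hn h5 hbad
    obtain ⟨K, iF, iN, hK, h4, hH, hL, -, hndvd⟩ := cruxOnQuarticPlusThreeCornerBelowTwenty_of_BT hBT p hn16 h19 h20000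
    exact ⟨K, iF, iN, hK, h4, hH, hL, hndvd⟩
  · rcases hWeq with rfl | rfl
    · obtain rfl := eq_of_not_good_Wminus hn h5 hbad
      obtain ⟨K, iF, iN, hK, h4, hH, hL, -, hndvd⟩ := cruxOnQuarticMinusCornerBelowTwenty_of_BT hBT p hn8 h23 h20000
      exact ⟨K, iF, iN, hK, h4, hH, hL, hndvd⟩
    · obtain rfl := eq_of_not_good_Wcube hn h5 hbad
      obtain ⟨K, iF, iN, hK, h4, hH, hL, -, hndvd⟩ := cruxOnQuarticMinusCubeCornerBelowTwenty_of_BT hBT p hn8 h23 h20000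
      exact ⟨K, iF, iN, hK, h4, hH, hL, hndvd⟩

end Summit.BirchSwinnertonDyer.BirchSwinnertonDyer.Theorems.BiquadraticEisensteinDescentHeegnerTwistCouplingInSupplyQuarticLayerBelowTwenty

end
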